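import Literature.Claims.NS.Higgins2026
import HarnessLib

/-!
# CLAIM C167 `Lietz2026` — «A Phase Calculus Proof of Global Regularity for the Three-Dimensional
Navier–Stokes Equations / Xi Quotient Descent and Physical Shell Transfer» (J. K. Lietz, preprint,
Zenodo record 20091655, 35 pp.; text of record = PDF «CF10_Lattice_Hydrodynamics.pdf»,
sha16 286b22e0329a2db8, PDF page = printed page; cell ns-claims, D-0090, RULINGS v1.43 (1))

[claim: Lietz2026, status: under-review] — NOTHING in this file is asserted as a theorem of the tree except
the declarations explicitly marked PROVED (pure logic / tree facts). Every `def Step_… : Prop` is the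
AUTHOR'S assertion, typed as printed, with its locator.

WHAT THIS IS NOT: not a claim about NS regularity or blow-up; not a claim about any author beyond the
typed locator.

## Claimed statement (Thm 2.1 p.4 l.3–15 = `ClaimedTheorem`, Clay (B)-shape)
«Let ν > 0, and let u₀ ∈ C^∞(𝕋³; ℝ³) be mean-zero and divergence-free. Then the incompressible
three-dimensional Navier–Stokes system (3)–(4) has a unique smooth solution u ∈ C^∞([0, ∞) × 𝕋³; ℝ³).»
Second face: Thm 2.3 p.4 l.28–35 (= Thm 18.8 p.26) on ℝ³ with Schwartz data = `ClaimedTheoremR3`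
(recorded as Clay (A) `ClayVariants.clayR3.Regularity`; its §18 «whole-space readout» composition is
not typed — it re-uses the 𝕋³ chain through Lemmas 18.1–18.7, > 3 extra Steps). Forced readouts
Thm 2.2 / 2.4 (author's «Xi-admissible forcing», Def 16.2 / 19.1) are RECORDED only.

## Kernel objects (p.4 l.48–92, (9)–(14); (99) p.16)
The print's `Δ_k` is an inhomogeneous smooth Littlewood–Paley partition on `𝕋³` with annuli
`A_k = {2^{k−1} ≤ |ξ| ≤ 2^{k+1}}` ((78) p.13 l.115–118). TYPED TWIN (grain note, not a Clay delta): the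
SHARP dyadic block `dyShell k = {n ∈ ℤ³ : 2^{2k−1} < |n|² ≤ 2^{2k+1}} ⊂ A_k` (disjoint in `k`, union
`ℤ³ ∖ {0}`, multiplier `1` at `|n| = 2^k`), over the tree's torus Fourier vocabulary
(`Higgins2026.coeff = mFourierCoeff ∘ complexify`, `Torus.freqNormSq`, `Torus.realTrigPoly`; lane
precedent `Higgins2026.shell/shellEnstrophy`). With `ω = vort u` (curl via `Torus.partialDeriv`):
`Om k u = Σ_{n ∈ dyShell k} ‖ω̂(n)‖²` (= (9) `‖Δ_kω‖²₂` by Parseval), `Dk ν k u = 2ν·4π² Σ |n|²‖ω̂(n)‖²`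
(= (10)), `Tk k u = 2 Re Σ_{n ∈ dyShell k} ⟪ω̂(n), Ĝ(n)⟫`, `G = (ω·∇)u − (u·∇)ω` (= (11) by Parseval),
`Tplus = max(Tk, 0)` ((99)), tails `Ytail/Ztail/Ptail` ((12)–(14), `tsum`, junk `0` if not summable),
`betaXi = 6 log₂ φ` ((34)), `rFib d = 1/(F_{d+1}F_{d+2})` ((18)/(31)).
Solutions: the tree's `Torus.IsClassicalNSSolutionOn S ν 0 u p` (jointly `C^∞` velocity/pressure on
`S × 𝕋³`), data `IsDatum` = smooth ∧ div-free ∧ mean-zero (Thm 2.1's class).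

## Phase-Calculus readouts (Def 4.2–4.4 p.5; RETYPE §1b of the REF)
`Ω^ξ_k, R^phys_k, H^front_k, R^ret_{ξ,k}, n_k` are «component readouts of the lifted physical shell packet
S_ξ(Y_k(t))», «canonically assigned by the retained calculus», with NO formula in `u` printed (sources =
the author's Lietz 2026a–h, App. A). They are typed as an abstract `XiReadout u` (functions `ℕ → ℝ → ℝ`
plus the printed definitional identities (25)/(131) and the depth calibration (84)/Prop 9.1); every printed
INEQUALITY about them is its own Step quantified over all readouts. These Steps feed (129) only through
the author's calculus («Combining (131), (76), (133), and (134) gives (129)», p.21 l.45) and are not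
kernel-composed below; the kernel composition starts at the physical statements (129)/(135)/(136)–(137).

## ORDERED STEP INDEX (dependency order of the printed Proof of Thm 2.1, p.23 l.63–76)
 1. `Step_BKM`      — local theory + Beale–Kato–Majda continuation (15) p.4 l.86–91. TRUE; PROVED (`step_BKM_holds`, tree RRS Thm 12.3 door).
 2. `Step_L51`      — Lemma 5.1 exact shell balance (26) p.6 l.7–26. TRUE-type (classical).
 3. `Step_P101`     — Prop 10.1 retained Xi lift exists (84)–(85) p.14 l.39–90 (with Prop 9.1 depth map p.13 l.113–p.14 l.38). Vacuous-type (abstract readout).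
 4. `Step_L62a`     — Lemma 6.2 (31) p.6 l.27–p.7 l.25, `B^k(1,1) = (F_{k+1}, F_{k+2})`. TRUE; PROVED (`step_L62a_holds`).
    `Step_L62b`     — Lemma 6.2 corridor `r_k ≤ C_r φ^{−2k}`. TRUE-type (Fibonacci growth), not proved here.
 5. `Step_T111`     — Thm 11.1 residual closure (90) p.15 l.3–60. Readout-type.
 6. `Step_L86`      — Lemma 8.6 germ projection law (69)–(70) p.12 l.76–93. Readout-type.
 7. `Step_T87`      — Thm 8.7 Xi tail bound (76) p.13 l.77–87. Readout-type.
 8. `Step_T84`      — Thm 8.4 routed excess (58)–(61) p.11 l.2–61 (free `L¹` term, RETYPE §1c). Readout-type.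
 9. `Step_L121`     — Lemma 12.1 (100) p.16 l.26–32, `C_LP` solution-independent and k-uniform AS PRINTED. CANDIDATE FALSE LEMMA (REF FAMILY F2 at t = 0).
    `Step_L121b`    — Lemma 12.1 (101) p.16 l.33–36. TRUE; PROVED (`step_L121b_holds`, `c_ν = 4π²` on the sharp block).
10. `Step_T124`     — Thm 12.4 (108) p.18 l.4–16 (free `L¹` term). Vacuous-type at print grain.
11. `Step_T133`     — Thm 13.3 (129) p.21 l.2–49, print-literal (constant per finite smooth `[0,T]`). TRUE-type (smoothness).
    `Step_T133_uniform` — (129) with the constant clause p.21 l.46–48 / Prop 14.1 l.61–63 read as a LEDGER function `F(ν, E(u₀), ‖∇u₀‖²₂)` (RETYPE flag (d)). Load-bearing face; REF FAMILY F1 at t = 0.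
12. `Step_P141`     — Prop 14.1 (135) p.21 l.50–63, VERBATIM conditional («if T* < ∞ … uniformly for 0 < T < T*»), the `C*_phys` clause. Load-bearing (UG-shape per RETYPE §1g).
13. `Step_T151`     — Thm 15.1 (136)–(137) p.22 l.3–34 as the implication its proof prints (uniform dyadic decay, βξ > 3 ⇒ uniform `‖ω‖_∞` bound; Bernstein (138)–(140)). TRUE-type.
14. `claim_of_steps : Step_P141 → Step_T151 → ClaimedTheorem` and
    `claim_of_steps_uniform : Step_T133_uniform → Step_T151 → ClaimedTheorem` — PROVED (maximal solution
    `Torus.exists_maximal_classicalNS_anyMean` + `step_BKM_holds`; uniqueness `claimedUniqueness_holds` PROVED).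
15. Clay link PROVED: `claimedTheorem_iff_clayB : ClaimedTheorem ↔ ClayVariants.clayPeriodic.Regularity`
    (mean-zero WLOG by the tree's Galilean boost `Torus.isClassicalNSSolutionOn_galileanBoost`).
-/

open Set MeasureTheory

namespace Literature.Claims.NS.Lietz2026

open Literature.Analysis Literature.Analysis.FluidPDE Literature.Analysis.FunctionSpaces
  Literature.Claims.NS.ClayVariants
open Literature.Claims.NS.Higgins2026 (T3 E3 C3 Z3 coeff latt)

noncomputable section

/-! ## Vocabulary -/

/-- The vorticity `ω = ∇ × v` on `𝕋³` ((8) p.4), componentwise with the tree's `Torus.partialDeriv`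
(indices `0,1,2`: `ω₀ = ∂₁v₂ − ∂₂v₁`, `ω₁ = ∂₂v₀ − ∂₀v₂`, `ω₂ = ∂₀v₁ − ∂₁v₀`; same formula as the tree's
`BDSV.curl`). [cite: Lietz2026, §3 (8) p.4 l.48–60] -/
def vort (v : T3 → E3) (x : T3) : E3 :=
  WithLp.toLp 2
    ![Torus.partialDeriv 1 v x 2 - Torus.partialDeriv 2 v x 1,
      Torus.partialDeriv 2 v x 0 - Torus.partialDeriv 0 v x 2,
      Torus.partialDeriv 0 v x 1 - Torus.partialDeriv 1 v x 0]

/-- The stretching-minus-advection field `G = (ω·∇)u − (u·∇)ω` paired in (11) (tree `Torus.convect a b =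
(a·∇)b`). [cite: Lietz2026, §3 (11) p.4 l.48–92] -/
def stretchAdv (v : T3 → E3) (x : T3) : E3 :=
  Torus.convect (vort v) v x - Torus.convect v (vort v) x

/-- **Sharp dyadic block** `dyShell k = {n ∈ ℤ³ : 2^{2k−1} < |n|² ≤ 2^{2k+1}}` — the typed twin of the
print's `Δ_k` (annulus `A_k = {2^{k−1} ≤ |ξ| ≤ 2^{k+1}}` (78)); `dyShell k ⊂ A_k`, the blocks are disjoint
and cover `ℤ³ ∖ {0}` (coordinates of such `n` lie in `[−2^{k+1}, 2^{k+1}]`).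
[cite: Lietz2026, §3 p.4 l.48–92; (78) p.13 l.115–118] -/
def dyShell (k : ℕ) : Finset Z3 :=
  (Fintype.piFinset fun _ : Fin 3 => Finset.Icc (-(2 ^ (k + 1) : ℤ)) (2 ^ (k + 1))).filter
    fun n => (2 : ℝ) ^ (2 * k) < 2 * Torus.freqNormSq n ∧ Torus.freqNormSq n ≤ 2 * (2 : ℝ) ^ (2 * k)

/-- `Δ_k w` at function level: the real trigonometric polynomial with the Fourier coefficients of `w` on
`dyShell k` and none outside (tree `Torus.realTrigPoly`). Recorded for the reader; the shell functionals
below are written spectrally (Parseval). [cite: Lietz2026, §3 p.4 l.48–92] -/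
def shellProj (k : ℕ) (w : T3 → E3) : T3 → E3 :=
  Torus.realTrigPoly (dyShell k) (coeff w)

/-- **(9) shell enstrophy** `Ω_k := ‖Δ_kω‖²_{L²} = Σ_{n ∈ dyShell k} ‖ω̂(n)‖²` (Parseval, sharp block).
[cite: Lietz2026, §3 (9) p.4 l.48–92] -/
def Om (k : ℕ) (v : T3 → E3) : ℝ :=
  ∑ n ∈ dyShell k, ‖coeff (vort v) n‖ ^ 2

/-- **(10) shell dissipation** `D_k := 2ν‖∇Δ_kω‖²_{L²} = 2ν · 4π² Σ_{n ∈ dyShell k} |n|²‖ω̂(n)‖²`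
(characters `e^{2πi n·x}`). [cite: Lietz2026, §3 (10) p.4 l.48–92] -/
def Dk (ν : ℝ) (k : ℕ) (v : T3 → E3) : ℝ :=
  2 * ν * (4 * Real.pi ^ 2 * ∑ n ∈ dyShell k, Torus.freqNormSq n * ‖coeff (vort v) n‖ ^ 2)

/-- **(11) shell transfer** `T_k := 2⟨Δ_kω, Δ_k[(ω·∇)u − (u·∇)ω]⟩_{L²} = 2 Re Σ_{n ∈ dyShell k} ⟪ω̂(n), Ĝ(n)⟫`
(Parseval, sharp block). [cite: Lietz2026, §3 (11) p.4 l.48–92] -/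
def Tk (k : ℕ) (v : T3 → E3) : ℝ :=
  2 * ∑ n ∈ dyShell k, (inner ℂ (coeff (vort v) n) (coeff (stretchAdv v) n)).re

/-- **(99) positive part** `T⁺_k := max{T_k, 0}`. [cite: Lietz2026, (99) p.16 l.20–25] -/
def Tplus (k : ℕ) (v : T3 → E3) : ℝ := max (Tk k v) 0

/-- **(12) weighted enstrophy tail** `Y_{β,K} := Σ_{k ≥ K} 2^{βk} Ω_k` (`tsum`; junk `0` if not summable).
[cite: Lietz2026, §3 (12) p.4 l.48–92] -/
def Ytail (β : ℝ) (K : ℕ) (v : T3 → E3) : ℝ :=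
  ∑' k : ℕ, if K ≤ k then (2 : ℝ) ^ (β * k) * Om k v else 0

/-- **(13) weighted dissipation tail** `Z_{β,K} := Σ_{k ≥ K} 2^{βk} D_k`. [cite: Lietz2026, §3 (13) p.4 l.48–92] -/
def Ztail (ν β : ℝ) (K : ℕ) (v : T3 → E3) : ℝ :=
  ∑' k : ℕ, if K ≤ k then (2 : ℝ) ^ (β * k) * Dk ν k v else 0

/-- **(14) weighted positive transfer tail** `P⁺_{β,K} := Σ_{k ≥ K} 2^{βk} T⁺_k`. [cite: Lietz2026, §3 (14) p.4 l.48–92] -/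
def Ptail (β : ℝ) (K : ℕ) (v : T3 → E3) : ℝ :=
  ∑' k : ℕ, if K ≤ k then (2 : ℝ) ^ (β * k) * Tplus k v else 0

/-- The golden ratio `φ = (1 + √5)/2` (Mathlib's `Real.goldenRatio`, spelled out). [folklore] -/
def phi : ℝ := (1 + Real.sqrt 5) / 2

/-- **(34) the tail exponent** `β_ξ := 6 log₂ φ = 4.16545… > 3`. [cite: Lietz2026, Thm 7.1 (34) p.7 l.37–52] -/
def betaXi : ℝ := 6 * Real.logb 2 phi

/-- **(18)/(31) Fibonacci corridor radius** `r_d = 1/(F_{d+1} F_{d+2})`. [cite: Lietz2026, (18) p.5 l.22–26; Lemma 6.2 (31) p.6 l.27–p.7 l.25] -/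
def rFib (d : ℕ) : ℝ := 1 / ((Nat.fib (d + 1) : ℝ) * Nat.fib (d + 2))

/-- Lemma 6.2's operator `B(u, v) = sort(v, u + v)` on increasing pairs. [cite: Lietz2026, Lemma 6.2 proof p.7 l.1–25] -/
def fibStep (q : ℕ × ℕ) : ℕ × ℕ := (q.2, q.1 + q.2)

/-- **Data class of Thm 2.1**: `u₀ ∈ C^∞(𝕋³; ℝ³)` mean-zero and divergence-free.
[cite: Lietz2026, Thm 2.1 p.4 l.3–6] -/
def IsDatum (u₀ : T3 → E3) : Prop :=
  Torus.IsSmooth u₀ ∧ Torus.IsDivFree u₀ ∧ Torus.HasZeroMean u₀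

/-! ## The Phase-Calculus readout (abstract; Def 4.2–4.4 p.5, Prop 9.1, Prop 10.1) -/

/-- **Retained-section readouts attached to a trajectory `u`** (Def 4.3 (21)–(23) p.5 l.49–63; Def 4.2
p.5 l.27–31 «canonically assigned by the retained calculus», no formula in `u` is printed): the
Xi-visible component `Ω^ξ_k(t)`, the residual `R^phys_k(t)`, the front `H^front_k(t)`, the retained quotient
residual `R^ret_{ξ,k}(t)` ((70)/(90)), the branch register `n_k(t)` ((18)/(69)), and the depth calibration
`d(k) = d₀ + k − k₀` (Prop 9.1 p.13 l.113–p.14 l.38, (84)), subject to the printed readout identity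
(25)/(131) `Ω_k = Ω^ξ_k + R^phys_k + H^front_k` (Lemma 4.1 p.5). Typed abstractly (RETYPE §1b).
[cite: Lietz2026, Def 4.3 (21)–(25) p.5 l.49–81; Prop 10.1 (84) p.14 l.39–90] -/
structure XiReadout (u : ℝ → T3 → E3) where
  /-- `Ω^ξ_k(t)`, the Xi-visible component (21). -/
  OmXi : ℕ → ℝ → ℝ
  /-- `R^phys_k(t)`, the projection-loss residual (22) (= `E^res_k`, (59)). -/
  Rphys : ℕ → ℝ → ℝ
  /-- `H^front_k(t)`, the active-front host component (23) (= `E^front_k`, (59)). -/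
  Hfront : ℕ → ℝ → ℝ
  /-- `R^ret_{ξ,k}(t)`, the retained Xi quotient residual ((70), (90)). -/
  Rret : ℕ → ℝ → ℝ
  /-- `n_k(t)`, the central-order branch register ((18), (69)). -/
  reg : ℕ → ℝ → ℝ
  /-- `k₀`, the calibration shell (Prop 9.1). -/
  k0 : ℕ
  /-- `d₀`, the calibration depth (Prop 9.1). -/
  d0 : ℕ
  /-- Lemma 4.1 (25) = (131): `Ω_k(t) = Ω^ξ_k(t) + R^phys_k(t) + H^front_k(t)`. -/
  sum_eq : ∀ (k : ℕ) (t : ℝ), Om k (u t) = OmXi k t + Rphys k t + Hfront k t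

/-- Depth of shell `k`: `d(k) = d₀ + k − k₀` (Prop 9.1; truncated subtraction below `k₀`).
[cite: Lietz2026, Prop 9.1 p.13 l.113–p.14 l.38] -/
def XiReadout.depth {u : ℝ → T3 → E3} (X : XiReadout u) (k : ℕ) : ℕ := X.d0 + k - X.k0

/-- Corridor radius of shell `k`: `r_k = r_{d(k)} = (F_{d(k)+1} F_{d(k)+2})⁻¹` ((84), (18)) — solution-independent.
[cite: Lietz2026, Prop 10.1 (84) p.14 l.39–48; (18) p.5 l.22–26] -/
def XiReadout.r {u : ℝ → T3 → E3} (X : XiReadout u) (k : ℕ) : ℝ := rFib (X.depth k)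

/-! ## The claimed statement -/

/-- **Existence half of Thm 2.1**: for `ν > 0` and `u₀` smooth, mean-zero, divergence-free on `𝕋³`, a
classical solution `(u, p)` of (3)–(4) on `[0, ∞) × 𝕋³` with `u(0) = u₀`.
[claim: Lietz2026, status: under-review] [cite: Lietz2026, Thm 2.1 p.4 l.3–15] -/
def ClaimedExistence : Prop :=
  ∀ ν : ℝ, 0 < ν → ∀ u₀ : T3 → E3, IsDatum u₀ →
    ∃ (u : ℝ → T3 → E3) (p : ℝ → T3 → ℝ), Torus.IsClassicalNSSolutionOn (Ici 0) ν 0 u p ∧ u 0 = u₀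

/-- **Uniqueness half of Thm 2.1** («unique smooth solution»): two classical solutions on `[0, ∞) × 𝕋³`
from the same datum have the same velocity. [claim: Lietz2026, status: under-review] [cite: Lietz2026, Thm 2.1 p.4 l.3–15] -/
def ClaimedUniqueness : Prop :=
  ∀ ν : ℝ, 0 < ν → ∀ u₀ : T3 → E3, IsDatum u₀ →
    ∀ (u v : ℝ → T3 → E3) (p q : ℝ → T3 → ℝ),
      Torus.IsClassicalNSSolutionOn (Ici 0) ν 0 u p → u 0 = u₀ →
      Torus.IsClassicalNSSolutionOn (Ici 0) ν 0 v q → v 0 = u₀ → ∀ t : ℝ, 0 ≤ t → v t = u t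

/-- **CLAIMED THEOREM = Thm 2.1 p.4 l.3–15** (periodic unforced global regularity and uniqueness).
[claim: Lietz2026, status: under-review] [cite: Lietz2026, Thm 2.1 p.4 l.3–15] -/
def ClaimedTheorem : Prop := ClaimedExistence ∧ ClaimedUniqueness

/-- **Second face, Thm 2.3 p.4 l.28–35 (= Thm 18.8 p.26 l.2–16)**: «Let ν > 0, and let u₀ ∈ 𝒮(ℝ³; ℝ³) be
divergence-free. Then the unforced … system on ℝ³ has a unique global smooth rapidly decaying solution» —
recorded as Clay (A) (`clayR3.Regularity`; the uniqueness clause and the §18 readout chain Lemmas 18.1–18.7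
are not typed). [claim: Lietz2026, status: under-review] [cite: Lietz2026, Thm 2.3 p.4 l.28–35; Thm 18.8 p.26 l.2–16] -/
def ClaimedTheoremR3 : Prop := clayR3.Regularity

/-! ## The Steps of the printed argument (dependency order of the Proof of Thm 2.1, p.23 l.63–76) -/

/-- **Step 1 — local theory and the Beale–Kato–Majda continuation (15) p.4 l.86–91** («a smooth solution on
[0, T*) extends past finite T* whenever ∫₀^{T*} ‖ω(t)‖_{L^∞} dt < ∞»), typed with a continuous majorant
`M(t) ≥ |ω(t, ·)|` (`torusVorticitySqAt = |ω|²`) and `∫₀ᵗ M ≤ I` on `[0, T)`. TRUE; PROVED below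
(`step_BKM_holds`). [claim: Lietz2026, status: under-review] [cite: Lietz2026, (15) p.4 l.86–91] [cite: RobinsonRodrigoSadowskiCUP2016, Thm 12.3] -/
def Step_BKM : Prop :=
  ∀ ν : ℝ, 0 < ν → ∀ T : ℝ, 0 < T → ∀ (u : ℝ → T3 → E3) (p : ℝ → T3 → ℝ),
    Torus.IsClassicalNSSolutionOn (Ico 0 T) ν 0 u p →
    ∀ M : ℝ → ℝ, ContinuousOn M (Ico 0 T) → (∀ t ∈ Ico 0 T, 0 ≤ M t) →
      (∀ t ∈ Ico 0 T, ∀ x : T3, torusVorticitySqAt (u t) x ≤ M t ^ 2) →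
      ∀ I : ℝ, (∀ t ∈ Ico 0 T, ∫ s in (0 : ℝ)..t, M s ≤ I) →
        ∃ T' : ℝ, T < T' ∧ ∃ (u' : ℝ → T3 → E3) (p' : ℝ → T3 → ℝ),
          Torus.IsClassicalNSSolutionOn (Icc 0 T') ν 0 u' p' ∧ ∀ t ∈ Ico 0 T, u' t = u t

/-- **Step 2 — Lemma 5.1 (exact shell balance) (26) p.6 l.7–26**: «d/dt Ω_k + D_k = T_k for every smooth
solution and every shell», typed as the one-sided derivative along a classical solution on `[0, T)`.
TRUE-type (vorticity equation (8) + Parseval on the sharp block); (27) follows by weighting.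
[claim: Lietz2026, status: under-review] [cite: Lietz2026, Lemma 5.1 (26)–(27) p.6 l.7–26] -/
def Step_L51 : Prop :=
  ∀ ν : ℝ, 0 < ν → ∀ T : ℝ, ∀ (u : ℝ → T3 → E3) (p : ℝ → T3 → ℝ),
    Torus.IsClassicalNSSolutionOn (Ico 0 T) ν 0 u p →
      ∀ k : ℕ, ∀ t ∈ Ico 0 T,
        HasDerivWithinAt (fun s => Om k (u s)) (Tk k (u t) - Dk ν k (u t)) (Ico 0 T) t

/-- **Step 3 — Prop 10.1 (retained Xi lift of a smooth trajectory) (84)–(85) p.14 l.39–90** (with Prop 9.1):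
for a smooth solution on `[0, T]` the retained section attaches to each shell the readouts and the Fibonacci
data `q_{d(k)} = B^{d(k)}(1,1)`, `r_{d(k)} = (F_{d(k)+1}F_{d(k)+2})⁻¹` «not selected by fitting the physical
shell flow» (p.14 l.47–48). Typed: a readout exists. Vacuous-type at kernel level (RETYPE §1b: satisfiable
by `Ω^ξ := 0, H^front := 0, R^phys := Ω_k`). [claim: Lietz2026, status: under-review] [cite: Lietz2026, Prop 10.1 (84)–(85) p.14 l.39–90; Prop 9.1 p.13 l.113–p.14 l.38] -/
def Step_P101 : Prop :=
  ∀ ν : ℝ, 0 < ν → ∀ T : ℝ, ∀ (u : ℝ → T3 → E3) (p : ℝ → T3 → ℝ),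
    Torus.IsClassicalNSSolutionOn (Icc 0 T) ν 0 u p → Nonempty (XiReadout u)

/-- **Step 4a — Lemma 6.2 (Fibonacci germ corridor) (31) p.6 l.27–p.7 l.25, matrix part**:
`B^k(1, 1) = (F_{k+1}, F_{k+2})`. TRUE; PROVED below (`step_L62a_holds`).
[claim: Lietz2026, status: under-review] [cite: Lietz2026, Lemma 6.2 (31) p.6 l.27–p.7 l.25] -/
def Step_L62a : Prop :=
  ∀ k : ℕ, fibStep^[k] (1, 1) = (Nat.fib (k + 1), Nat.fib (k + 2))

/-- **Step 4b — Lemma 6.2 corridor bound** «r_k ≤ C_r φ^{−2k}». TRUE-type (Fibonacci growth `F_n ≍ φⁿ/√5`);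
not proved here. [claim: Lietz2026, status: under-review] [cite: Lietz2026, Lemma 6.2 (31) p.6 l.27–p.7 l.25] -/
def Step_L62b : Prop :=
  ∃ Cr : ℝ, 0 < Cr ∧ ∀ k : ℕ, rFib k ≤ Cr * phi ^ (-(2 * (k : ℝ)))

/-- **Step 5 — Thm 11.1 (residual closure inside the retained Xi engine) (90) p.15 l.3–60**:
«sup_{0≤t≤T} sup_{k≥0} R^ret_{ξ,k}(t) ≤ C_R(T) < ∞» on every finite smooth interval. Readout-type.
[claim: Lietz2026, status: under-review] [cite: Lietz2026, Thm 11.1 (90) p.15 l.3–60] -/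
def Step_T111 : Prop :=
  ∀ ν : ℝ, 0 < ν → ∀ T : ℝ, ∀ (u : ℝ → T3 → E3) (p : ℝ → T3 → ℝ),
    Torus.IsClassicalNSSolutionOn (Icc 0 T) ν 0 u p → ∀ X : XiReadout u,
      ∃ CR : ℝ, ∀ k : ℕ, ∀ t ∈ Icc 0 T, X.Rret k t ≤ CR

/-- **Step 6 — Lemma 8.6 (germ projection law) (69)–(70) p.12 l.76–93**: «Ω^ξ_k(t) ≤ C_ACM r_k(t)⁴(1 + |n_k(t)|)»
and «|n_k(t)| ≤ C_Ω R^ret_{ξ,k}(t)/r_k(t)». Readout-type. [claim: Lietz2026, status: under-review] [cite: Lietz2026, Lemma 8.6 (69)–(70) p.12 l.76–93] -/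
def Step_L86 : Prop :=
  ∀ ν : ℝ, 0 < ν → ∀ T : ℝ, ∀ (u : ℝ → T3 → E3) (p : ℝ → T3 → ℝ),
    Torus.IsClassicalNSSolutionOn (Icc 0 T) ν 0 u p → ∀ X : XiReadout u,
      ∃ CACM COm : ℝ, ∀ k : ℕ, ∀ t ∈ Icc 0 T,
        X.OmXi k t ≤ CACM * X.r k ^ 4 * (1 + |X.reg k t|) ∧
          |X.reg k t| ≤ COm * X.Rret k t / X.r k

/-- **Step 7 — Thm 8.7 (Xi quotient descent tail bound) (76) p.13 l.77–87**: «Ω^ξ_k(t) ≤ C^ξ_T 2^{−β_ξ k},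
β_ξ = 6 log₂ φ > 3, for every finite interval [0, T]». Readout-type. [claim: Lietz2026, status: under-review] [cite: Lietz2026, Thm 8.7 (76) p.13 l.77–87] -/
def Step_T87 : Prop :=
  ∀ ν : ℝ, 0 < ν → ∀ T : ℝ, ∀ (u : ℝ → T3 → E3) (p : ℝ → T3 → ℝ),
    Torus.IsClassicalNSSolutionOn (Icc 0 T) ν 0 u p → ∀ X : XiReadout u,
      ∃ CxiT : ℝ, ∀ k : ℕ, ∀ t ∈ Icc 0 T, X.OmXi k t ≤ CxiT * (2 : ℝ) ^ (-(betaXi * k))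

/-- **Step 8 — Thm 8.4 (dynamic routed-excess control) (58)–(61) p.11 l.2–61**: with `E^exc_k := Ω_k − Ω^ξ_k`
(58) routed as `E^res_k = R^phys_k`, `E^front_k = H^front_k` (59): (60) «E^res_k(t) ≤ C_res Σ_{|d−d(k)|≤m_LP}
r_d(t)⁴(1 + |n_d(t)|)» and (61) «∫₀ᵀ Σ_{k≥K_ξ} 2^{β_ξ k} E^front_k dt ≤ η_front ∫₀ᵀ Z_{β_ξ,K_ξ} dt + ∫₀ᵀ B_front dt,
0 < η_front < 1, B_front ∈ L¹(0, T)» (no bound on `‖B_front‖_{L¹}` is printed — RETYPE §1c). Readout-type.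
[claim: Lietz2026, status: under-review] [cite: Lietz2026, Thm 8.4 (58)–(61) p.11 l.2–61] -/
def Step_T84 : Prop :=
  ∀ ν : ℝ, 0 < ν → ∀ T : ℝ, ∀ (u : ℝ → T3 → E3) (p : ℝ → T3 → ℝ),
    Torus.IsClassicalNSSolutionOn (Icc 0 T) ν 0 u p → ∀ X : XiReadout u,
      (∃ Cres : ℝ, ∃ mLP : ℕ, ∀ k : ℕ, ∀ t ∈ Icc 0 T,
        X.Rphys k t ≤ Cres * ∑ k' ∈ Finset.Icc (k - mLP) (k + mLP), X.r k' ^ 4 * (1 + |X.reg k' t|)) ∧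
      ∃ Kxi : ℕ, ∃ eta : ℝ, 0 < eta ∧ eta < 1 ∧ ∃ Bfront : ℝ → ℝ,
        IntegrableOn Bfront (Ioo 0 T) ∧
        ∫ t in (0 : ℝ)..T, (∑' k : ℕ, if Kxi ≤ k then (2 : ℝ) ^ (betaXi * k) * X.Hfront k t else 0) ≤
          eta * ∫ t in (0 : ℝ)..T, Ztail ν betaXi Kxi (u t) + ∫ t in (0 : ℝ)..T, Bfront t

/-- **Step 9 — Lemma 12.1 (dyadic stretching estimate) (100) p.16 l.26–32**: «There is a Littlewood–Paley
constant C_LP such that T⁺_k(t) ≤ C_LP 2^{3k/2} Ω_k(t)^{3/2}» — `C_LP` solution-independent and k-uniform AS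
PRINTED (consumed so in (109) p.18 l.17–22 and Prop 14.1's proof p.21 l.71–74), along every classical solution
from a datum of Thm 2.1's class, all shells `k ≥ 1`. CANDIDATE FALSE LEMMA (REF RETYPE §1e, FAMILY F2 at t = 0:
`Δ_k` of the product receives low–high input from other shells). [claim: Lietz2026, status: under-review] [cite: Lietz2026, Lemma 12.1 (100) p.16 l.26–32] -/
def Step_L121 : Prop :=
  ∃ CLP : ℝ, ∀ ν : ℝ, 0 < ν → ∀ u₀ : T3 → E3, IsDatum u₀ →
    ∀ T : ℝ, ∀ (u : ℝ → T3 → E3) (p : ℝ → T3 → ℝ),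
      Torus.IsClassicalNSSolutionOn (Ico 0 T) ν 0 u p → u 0 = u₀ →
        ∀ k : ℕ, 1 ≤ k → ∀ t ∈ Ico 0 T,
          Tplus k (u t) ≤ CLP * (2 : ℝ) ^ ((3 : ℝ) * k / 2) * Om k (u t) ^ ((3 : ℝ) / 2)

/-- **Step 9b — Lemma 12.1 (101) p.16 l.33–36**: «There is c_ν > 0 such that D_k(t) ≥ c_ν ν 2^{2k} Ω_k(t) for
k ≥ 1». TRUE on the sharp block (`|n|² > 2^{2k−1}` there; `c_ν = 4π²`); PROVED below (`step_L121b_holds`).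
[claim: Lietz2026, status: under-review] [cite: Lietz2026, Lemma 12.1 (101) p.16 l.33–36] -/
def Step_L121b : Prop :=
  ∃ cnu : ℝ, 0 < cnu ∧ ∀ ν : ℝ, 0 < ν → ∀ v : T3 → E3, ∀ k : ℕ, 1 ≤ k →
    cnu * ν * (2 : ℝ) ^ (2 * k) * Om k v ≤ Dk ν k v

/-- **Step 10 — Thm 12.4 (integrated positive pressure is absorbed above the Xi front) (108) p.18 l.4–16**:
«For every finite [0, T] there is a fixed Xi front K_ξ and a number 0 < η < 1 such that P⁺_{β_ξ,K_ξ}(t) ≤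
η Z_{β_ξ,K_ξ}(t) + B_β(t), B_β ∈ L¹(0, T), for 0 ≤ t ≤ T» (no bound on `‖B_β‖_{L¹}` printed — vacuous-type at
print grain, RETYPE §1f). [claim: Lietz2026, status: under-review] [cite: Lietz2026, Thm 12.4 (108) p.18 l.4–16] -/
def Step_T124 : Prop :=
  ∀ ν : ℝ, 0 < ν → ∀ T : ℝ, 0 < T → ∀ (u : ℝ → T3 → E3) (p : ℝ → T3 → ℝ),
    Torus.IsClassicalNSSolutionOn (Icc 0 T) ν 0 u p →
      ∃ Kxi : ℕ, ∃ eta : ℝ, 0 < eta ∧ eta < 1 ∧ ∃ Bβ : ℝ → ℝ, IntegrableOn Bβ (Ioo 0 T) ∧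
        ∀ t ∈ Icc 0 T, Ptail betaXi Kxi (u t) ≤ eta * Ztail ν betaXi Kxi (u t) + Bβ t

/-- **Step 11 — Thm 13.3 (retained Xi tail transfers to physical shells) (129) p.21 l.2–49, PRINT-LITERAL**:
«Ω_k(t) ≤ C_phys(T) 2^{−β_ξ k}» with one constant per finite smooth interval `[0, T]`. TRUE-type for every
classical solution (smoothness on the compact slab ⇒ super-polynomial Fourier decay of `ω`; the exponent
carries no information at this grain — RETYPE §1d R1). [claim: Lietz2026, status: under-review] [cite: Lietz2026, Thm 13.3 (129) p.21 l.2–49] -/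
def Step_T133 : Prop :=
  ∀ ν : ℝ, 0 < ν → ∀ T : ℝ, ∀ (u : ℝ → T3 → E3) (p : ℝ → T3 → ℝ),
    Torus.IsClassicalNSSolutionOn (Icc 0 T) ν 0 u p →
      ∃ Cphys : ℝ, ∀ k : ℕ, ∀ t ∈ Icc 0 T, Om k (u t) ≤ Cphys * (2 : ℝ) ^ (-(betaXi * k))

/-- **Step 11′ — (129) with its constant clause, LEDGER-UNIFORM face** (p.21 l.46–48 «The constant C_phys(T)
depends only on the allowed objects listed in Theorem 14.1: initial energy/enstrophy data, viscosity,
Littlewood–Paley/Bernstein constants, retained Xi calibration constants, finite front ledger constants»;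
Prop 14.1 l.61–63 «can be chosen uniformly for 0 < T < T*… do not depend on sup_{t<T*}‖u(t)‖_{H^s}»): one
function `F(ν, E(u₀), ‖∇u₀‖²₂)` of the initial energy/enstrophy ledger bounds `Ω_k(t) 2^{β_ξ k}` along every
classical solution on every half-open slab `[0, T)` (REF flag (d); FAMILY F1 at t = 0).
[claim: Lietz2026, status: under-review] [cite: Lietz2026, Thm 13.3 (129) p.21 l.2–4, l.46–48; Prop 14.1 (135) p.21 l.61–63] -/
def Step_T133_uniform : Prop :=
  ∃ F : ℝ → ℝ → ℝ → ℝ, ∀ ν : ℝ, 0 < ν → ∀ u₀ : T3 → E3, IsDatum u₀ →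
    ∀ T : ℝ, 0 < T → ∀ (u : ℝ → T3 → E3) (p : ℝ → T3 → ℝ),
      Torus.IsClassicalNSSolutionOn (Ico 0 T) ν 0 u p → u 0 = u₀ →
        ∀ k : ℕ, ∀ t ∈ Ico 0 T,
          Om k (u t) ≤ F ν (Torus.kineticEnergy u₀) (Torus.gradNormSq u₀) * (2 : ℝ) ^ (-(betaXi * k))

/-- **Step 12 — Prop 14.1 (uniform retained constants on a maximal smooth interval) (135) p.21 l.50–63,
VERBATIM CONDITIONAL**: «Let [0, T*) be the maximal smooth interval for smooth periodic data. If T* < ∞, the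
constants C^ξ_*, C*_R, B*_β, C*_phys, K_ξ, C*_front (135) can be chosen uniformly for 0 < T < T*», typed for the
`C*_phys` clause (the (129) constant — the one Thm 15.1 consumes, p.22 l.32–33; the other five constants bound
the abstract readouts of Steps 5–8/10). «Maximal»: `(u, p)` classical on `[0, T*)` from `u₀` and no classical
solution through `u₀` lives on a closed window `[0, b]` with `b ≥ T*`. Load-bearing (RETYPE §1g: proof
l.64–87 is a dependency list). [claim: Lietz2026, status: under-review] [cite: Lietz2026, Prop 14.1 (135) p.21 l.50–63] -/
def Step_P141 : Prop :=
  ∀ ν : ℝ, 0 < ν → ∀ u₀ : T3 → E3, IsDatum u₀ →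
    ∀ Tstar : ℝ, 0 < Tstar → ∀ (u : ℝ → T3 → E3) (p : ℝ → T3 → ℝ),
      Torus.IsClassicalNSSolutionOn (Ico 0 Tstar) ν 0 u p → u 0 = u₀ →
      (∀ (b : ℝ) (v : ℝ → T3 → E3) (q : ℝ → T3 → ℝ),
          Torus.IsClassicalNSSolutionOn (Icc 0 b) ν 0 v q → v 0 = u₀ → b < Tstar) →
        ∃ Cphys : ℝ, ∀ T : ℝ, T < Tstar → ∀ k : ℕ, ∀ t ∈ Icc 0 T,
          Om k (u t) ≤ Cphys * (2 : ℝ) ^ (-(betaXi * k))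

/-- **Step 13 — Thm 15.1 (uniform summability of the vorticity tail) (136)–(137) p.22 l.3–34**, typed as the
implication its proof prints (Bernstein (138)–(139) `Σ_k ‖Δ_kω‖_∞ ≤ C_B C_phys^{1/2} Σ_k 2^{(3−β_ξ)k/2} < ∞` since
`β_ξ > 3`, low shells (140) by energy): a uniform dyadic decay constant on `[0, T)` yields a uniform bound on
`‖ω(t)‖_{L^∞}`, `t ∈ [0, T)` (`torusVorticitySqAt = |ω|²` pointwise). TRUE-type (classical).
[claim: Lietz2026, status: under-review] [cite: Lietz2026, Thm 15.1 (136)–(140) p.22 l.3–34] -/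
def Step_T151 : Prop :=
  ∀ ν : ℝ, 0 < ν → ∀ T : ℝ, 0 < T → ∀ (u : ℝ → T3 → E3) (p : ℝ → T3 → ℝ),
    Torus.IsClassicalNSSolutionOn (Ico 0 T) ν 0 u p →
      (∃ C : ℝ, ∀ k : ℕ, ∀ t ∈ Ico 0 T, Om k (u t) ≤ C * (2 : ℝ) ^ (-(betaXi * k))) →
        ∃ B : ℝ, ∀ t ∈ Ico 0 T, ∀ x : T3, torusVorticitySqAt (u t) x ≤ B ^ 2

/-! ## PROVED: tree facts among the Steps -/

/-- **Step 1 HOLDS (kernel)**: the torus Beale–Kato–Majda door of the tree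
(`Torus.classicalNS_bkm_continuation_anyMean`, RRS 2016 Thm 12.3 with the Galilean reduction).
[cite: RobinsonRodrigoSadowskiCUP2016, Thm 12.3] [cite: Lietz2026, (15) p.4 l.86–91] -/
theorem step_BKM_holds : Step_BKM :=
  fun _ν hν _T hT _u _p h _M hMc hM0 hω _I hI =>
    Torus.classicalNS_bkm_continuation_anyMean (d := Fin 3) (by simp) hν hT h hMc hM0 hω hI

/-- **Step 4a HOLDS (kernel)**: `B^k(1,1) = (F_{k+1}, F_{k+2})` by induction (`F₁ = F₂ = 1`,
`F_{k+3} = F_{k+1} + F_{k+2}`). [cite: Lietz2026, Lemma 6.2 (31) p.6 l.27–p.7 l.25] -/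
theorem step_L62a_holds : Step_L62a := by
  intro k
  induction k with
  | zero => simp [Nat.fib_two]
  | succ k ih =>
    rw [Function.iterate_succ_apply', ih, fibStep]
    ext
    · rfl
    · show Nat.fib (k + 1) + Nat.fib (k + 2) = Nat.fib (k + 1 + 2)
      rw [Nat.fib_add_two (n := k + 1)]

/-- On the sharp block, `2^{2k} < 2|n|²`. [cite: Lietz2026, (78) p.13 l.115–118] -/
theorem two_pow_lt_of_mem_dyShell {k : ℕ} {n : Z3} (hn : n ∈ dyShell k) :
    (2 : ℝ) ^ (2 * k) < 2 * Torus.freqNormSq n :=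
  ((Finset.mem_filter.1 hn).2).1

/-- **Step 9b HOLDS (kernel)** with `c_ν = 4π²`: termwise `4π² ν 2^{2k} ‖ω̂(n)‖² ≤ 2ν · 4π² |n|² ‖ω̂(n)‖²` on the
block. [cite: Lietz2026, Lemma 12.1 (101) p.16 l.33–36] -/
theorem step_L121b_holds : Step_L121b := by
  refine ⟨4 * Real.pi ^ 2, by positivity, fun ν hν v k _ => ?_⟩
  unfold Dk Om
  rw [Finset.mul_sum, Finset.mul_sum, Finset.mul_sum]
  refine Finset.sum_le_sum fun n hn => ?_
  have h2 : (2 : ℝ) ^ (2 * k) ≤ 2 * Torus.freqNormSq n := (two_pow_lt_of_mem_dyShell hn).le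
  have ha : 0 ≤ ‖coeff (vort v) n‖ ^ 2 := sq_nonneg _
  calc 4 * Real.pi ^ 2 * ν * (2 : ℝ) ^ (2 * k) * ‖coeff (vort v) n‖ ^ 2
      ≤ 4 * Real.pi ^ 2 * ν * (2 * Torus.freqNormSq n) * ‖coeff (vort v) n‖ ^ 2 := by
        gcongr
    _ = 2 * ν * (4 * Real.pi ^ 2 * (Torus.freqNormSq n * ‖coeff (vort v) n‖ ^ 2)) := by ring

/-- **The uniqueness half of Thm 2.1 HOLDS (kernel), unconditionally** (maximality clause of the tree's
`Torus.exists_maximal_classicalNS_anyMean`). [cite: RobinsonRodrigoSadowskiCUP2016, §6.3 p. 108 (Thm. 6.10 uniqueness)] [cite: Lietz2026, Thm 2.1 p.4 l.3–15] -/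
theorem claimedUniqueness_holds : ClaimedUniqueness := by
  intro ν hν u₀ hu₀ v w q r hv hv0 hw hw0 t ht
  rcases ht.eq_or_lt with rfl | ht'
  · rw [hw0, hv0]
  obtain ⟨u, p, -, hcases⟩ :=
    Torus.exists_maximal_classicalNS_anyMean (d := Fin 3) (by simp) hν hu₀.1 hu₀.2.1
  have hvI := hv.mono Icc_subset_Ici_self (uniqueDiffOn_Icc ht')
  have hwI := hw.mono Icc_subset_Ici_self (uniqueDiffOn_Icc ht')
  rcases hcases with ⟨-, hmax⟩ | ⟨T, -, -, -, hmax⟩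
  · rw [hmax t v q hvI hv0 t ⟨ht, le_rfl⟩, hmax t w r hwI hw0 t ⟨ht, le_rfl⟩]
  · rw [(hmax t v q hvI hv0).2 t ⟨ht, le_rfl⟩, (hmax t w r hwI hw0).2 t ⟨ht, le_rfl⟩]

/-! ## COMPOSITION OF THE PRINTED CHAIN (PROVED, pure logic + tree facts) -/

/-- From a uniform dyadic decay constant along a classical solution on `[0, T)` (`T > 0`) the chain's tail
closes: Thm 15.1 gives a uniform vorticity bound, the BKM door (Step 1, proved) continues the solution to a
closed window `[0, T']`, `T' > T`, through the same datum. [cite: Lietz2026, Proof of Thm 2.1 p.23 l.70–76] -/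
theorem continuation_of_decay (h151 : Step_T151) {ν : ℝ} (hν : 0 < ν) {T : ℝ} (hT : 0 < T)
    {u : ℝ → T3 → E3} {p : ℝ → T3 → ℝ} (hcl : Torus.IsClassicalNSSolutionOn (Ico 0 T) ν 0 u p)
    (hdec : ∃ C : ℝ, ∀ k : ℕ, ∀ t ∈ Ico 0 T, Om k (u t) ≤ C * (2 : ℝ) ^ (-(betaXi * k))) :
    ∃ T' : ℝ, T < T' ∧ ∃ (u' : ℝ → T3 → E3) (p' : ℝ → T3 → ℝ),
      Torus.IsClassicalNSSolutionOn (Icc 0 T') ν 0 u' p' ∧ u' 0 = u 0 := by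
  obtain ⟨B, hB⟩ := h151 ν hν T hT u p hcl hdec
  obtain ⟨T', hTT', u', p', hcl', hagree⟩ :=
    step_BKM_holds ν hν T hT u p hcl (fun _ => |B|) continuousOn_const (fun _ _ => abs_nonneg B)
      (fun t ht x => by rw [sq_abs]; exact hB t ht x) (T * |B|)
      (fun t ht => by
        rw [intervalIntegral.integral_const, smul_eq_mul, sub_zero]
        exact mul_le_mul_of_nonneg_right ht.2.le (abs_nonneg B))
  exact ⟨T', hTT', u', p', hcl', hagree 0 ⟨le_rfl, hT⟩⟩

/-- **COMPOSITION (PROVED)** — Proof of Thm 2.1 p.23 l.63–76 from its two physical load-bearing links: the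
maximal classical solution exists (tree, RRS §6.3/§8.1); if `T* < ∞`, Prop 14.1 (Step 12) gives the uniform
(129) on `[0, T*)`, Thm 15.1 (Step 13) the uniform `‖ω‖_∞` bound, and BKM (Step 1, proved) a continuation past
`T*`, contradicting maximality; uniqueness is `claimedUniqueness_holds`. Steps 2–11 feed Step 12 only through
the author's Phase-Calculus readouts and are not consumed here (module docstring).
[cite: Lietz2026, Proof of Thm 2.1 p.23 l.63–76] -/
theorem claim_of_steps (h141 : Step_P141) (h151 : Step_T151) : ClaimedTheorem := by
  refine ⟨?_, claimedUniqueness_holds⟩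
  intro ν hν u₀ hu₀
  obtain ⟨u, p, hu0, hcases⟩ :=
    Torus.exists_maximal_classicalNS_anyMean (d := Fin 3) (by simp) hν hu₀.1 hu₀.2.1
  rcases hcases with ⟨hglob, -⟩ | ⟨T, hT, hcl, -, hmax⟩
  · exact ⟨u, p, hglob, hu0⟩
  · exfalso
    have hmax' : ∀ (b : ℝ) (v : ℝ → T3 → E3) (q : ℝ → T3 → ℝ),
        Torus.IsClassicalNSSolutionOn (Icc 0 b) ν 0 v q → v 0 = u₀ → b < T :=
      fun b v q hv hv0 => (hmax b v q hv hv0).1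
    obtain ⟨C, hC⟩ := h141 ν hν u₀ hu₀ T hT u p hcl hu0 hmax'
    obtain ⟨T', hTT', u', p', hcl', hu'0⟩ :=
      continuation_of_decay h151 hν hT hcl ⟨C, fun k t ht => hC t ht.2 k t ⟨ht.1, le_rfl⟩⟩
    exact absurd hTT' (not_lt.2 (hmax' T' u' p' hcl' (hu'0.trans hu0)).le)

/-- **COMPOSITION from the ledger-uniform face (PROVED)**: Step 11′ + Step 13 ⇒ Thm 2.1 (same tail).
[cite: Lietz2026, Proof of Thm 2.1 p.23 l.63–76; Thm 13.3 p.21 l.46–48] -/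
theorem claim_of_steps_uniform (h133 : Step_T133_uniform) (h151 : Step_T151) : ClaimedTheorem := by
  refine ⟨?_, claimedUniqueness_holds⟩
  intro ν hν u₀ hu₀
  obtain ⟨F, hF⟩ := h133
  obtain ⟨u, p, hu0, hcases⟩ :=
    Torus.exists_maximal_classicalNS_anyMean (d := Fin 3) (by simp) hν hu₀.1 hu₀.2.1
  rcases hcases with ⟨hglob, -⟩ | ⟨T, hT, hcl, -, hmax⟩
  · exact ⟨u, p, hglob, hu0⟩
  · exfalso
    obtain ⟨T', hTT', u', p', hcl', hu'0⟩ :=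
      continuation_of_decay h151 hν hT hcl ⟨_, fun k t ht => hF ν hν u₀ hu₀ T hT u p hcl hu0 k t ht⟩
    exact absurd hTT' (not_lt.2 (hmax T' u' p' hcl' (hu'0.trans hu0)).1.le)

/-! ## CLAY LINK (PROVED): Thm 2.1 is EXACTLY Clay (B) -/

/-- Mean-zero reduction: Thm 2.1's existence (mean-zero data) gives existence for every smooth divergence-free
datum on `𝕋³` by the Galilean boost `u(t, x) = w(t, x − t m) + m`, `m = ∫u₀`, `w` the solution from `u₀ − m`
(tree `Torus.isClassicalNSSolutionOn_galileanBoost`). [cite: MajdaBertozzi2002, §1.2 (Galilean invariance)] [cite: Lietz2026, Thm 2.1 p.4 l.3–15] -/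
theorem higginsExistence_of_claimedExistence (h : ClaimedExistence) : Higgins2026.ClaimedExistence := by
  intro ν hν u₀ hs hd
  set m : E3 := ∫ y, u₀ y with hm
  have hV₀smooth : Torus.IsSmooth (fun x => u₀ x - m) := Torus.isSmooth_sub_const hs m
  have hV₀div : Torus.IsDivFree (fun x => u₀ x - m) := Torus.isDivFree_sub_const hd m
  have hV₀mean : Torus.HasZeroMean (fun x => u₀ x - m) := by
    unfold Torus.HasZeroMean
    have h' := Torus.integral_comp_add_right_sub_const hs.integrable 0 m
    simp only [add_zero] at h'
    rw [h', hm, sub_self]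
  obtain ⟨W, Q, hW, hW0⟩ := h ν hν (fun x => u₀ x - m) ⟨hV₀smooth, hV₀div, hV₀mean⟩
  refine ⟨fun t x => W t (x + Torus.proj (t • (-m))) - (-m), fun t x => Q t (x + Torus.proj (t • (-m))),
    Torus.isClassicalNSSolutionOn_galileanBoost (uniqueDiffOn_Ici 0) hW (-m), ?_⟩
  funext x
  simp only [zero_smul, Torus.proj_zero, add_zero, hW0, sub_neg_eq_add, sub_add_cancel]

/-- **CLAY LINK (PROVED)**: `ClaimedTheorem → clayPeriodic.Regularity` (Clay (B), Fefferman (8)/(10)/(11)) via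
the lane-precedent door `Higgins2026.clay_of_claimed` after the mean-zero reduction.
[cite: FeffermanClay2006, (B) with (8) (10) (11) p. 2] [cite: Lietz2026, Thm 2.1 p.4 l.3–15] -/
theorem clayB_of_claimed (h : ClaimedTheorem) : clayPeriodic.Regularity :=
  Higgins2026.clay_of_claimed ⟨higginsExistence_of_claimedExistence h.1, Higgins2026.claimedUniqueness_holds⟩

/-- Conversely Clay (B) gives Thm 2.1 (restrict to mean-zero data; uniqueness is a tree fact).
[cite: FeffermanClay2006, (B) p. 2] [cite: Lietz2026, Thm 2.1 p.4 l.3–15] -/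
theorem claimed_of_clayB (h : clayPeriodic.Regularity) : ClaimedTheorem :=
  ⟨fun ν hν u₀ hu₀ => Higgins2026.claimedExistence_of_clayB h ν hν u₀ hu₀.1 hu₀.2.1, claimedUniqueness_holds⟩

/-- **Thm 2.1 ⇔ Clay (B)** (letter: EXACTLY (B); the mean-zero clause is a WLOG normalisation).
[cite: FeffermanClay2006, (B) p. 2] [cite: Lietz2026, Thm 2.1 p.4 l.3–15] -/
theorem claimedTheorem_iff_clayB : ClaimedTheorem ↔ clayPeriodic.Regularity :=
  ⟨clayB_of_claimed, claimed_of_clayB⟩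

/-! ## D-0026 discharge of `Step_L51` (Lemma 5.1 (26)): the exact shell-enstrophy balance

Appended 2026-08-27 (ns-claims typist-3 g7, custodian GO typist-7 g8 16:26:12Z); every earlier line of
this file is unchanged. Route (classical, per Fourier mode on the sharp block `dyShell k`):
`d/ds v̂(n) = 𝓕(∂ₜu)(n)` within `[0, T)` (differentiation under the integral,
`Torus.IsSmoothSpaceTimeOn.hasDerivWithinAt_integral`), `ω̂(n) = 2πi n × v̂(n)`
(`Torus.mFourierCoeff_complexify_partialDeriv`), the momentum equation gives
`𝓕(∂ₜu)(n) = −ν4π²|n|² v̂(n) − 2πi n p̂(n) − 𝓕((u·∇)u)(n)` (`Torus.mFourierCoeff_complexify_laplacian`,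
`Torus.mFourierCoeff_complexify_gradient_apply_eq`), the pressure drops out under `n ×`, and the
inertial term is `curl((u·∇)u) = (u·∇)ω − (ω·∇)u` for divergence-free `u`
(`Torus.partialDeriv_convect_self_eq_add` + first-order algebra), whence
`d/dt ω̂(n) = −ν4π²|n|² ω̂(n) + Ĝ(n)` and `d‖ω̂(n)‖² = 2 Re⟪ω̂(n), ω̂'(n)⟫`, summed over the finite
block: `dΩ_k/dt = T_k − D_k` exactly as typed. No new definitions, no new named facts. -/

section StepL51Discharge

open Filter Topology
open scoped InnerProductSpace ComplexConjugate ContDiff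

/-! ### Components of the vorticity (`vort = BDSV.curl` definitionally) -/

/-- Helper (`vort_apply_zero`), private to this discharge. [folklore] -/
private theorem vort_apply_zero (w : T3 → E3) (y : T3) :
    vort w y 0 = Torus.partialDeriv 1 w y 2 - Torus.partialDeriv 2 w y 1 :=
  BDSV.curl_apply_zero w y

/-- Helper (`vort_apply_one`), private to this discharge. [folklore] -/
private theorem vort_apply_one (w : T3 → E3) (y : T3) :
    vort w y 1 = Torus.partialDeriv 2 w y 0 - Torus.partialDeriv 0 w y 2 :=
  BDSV.curl_apply_one w y

/-- Helper (`vort_apply_two`), private to this discharge. [folklore] -/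
private theorem vort_apply_two (w : T3 → E3) (y : T3) :
    vort w y 2 = Torus.partialDeriv 0 w y 1 - Torus.partialDeriv 1 w y 0 :=
  BDSV.curl_apply_two w y

/-- Helper (`isSmooth_vort`), private to this discharge. [folklore] -/
private theorem isSmooth_vort {v : T3 → E3} (hv : Torus.IsSmooth v) : Torus.IsSmooth (vort v) :=
  BDSV.isSmooth_curl hv

/-! ### (b) Fourier coefficients of the vorticity: `ω̂(n) = 2πi n × v̂(n)` componentwise -/

/-- `𝓕((∂_a v)_b − (∂_b v)_a)(n) = 2πi (n_a v̂(n)_b − n_b v̂(n)_a)` for smooth `v`. [folklore] -/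
private theorem mFourierCoeff_partialDeriv_pair {v : T3 → E3} (hv : Torus.IsSmooth v)
    (a b : Fin 3) (n : Z3) :
    UnitAddTorus.mFourierCoeff
        (fun x => ((Torus.partialDeriv a v x b - Torus.partialDeriv b v x a : ℝ) : ℂ)) n =
      2 * Real.pi * Complex.I * ((n a : ℂ) * coeff v n b - (n b : ℂ) * coeff v n a) := by
  have hone : ∀ a b : Fin 3,
      UnitAddTorus.mFourierCoeff (fun x => ((Torus.partialDeriv a v x b : ℝ) : ℂ)) n =
        2 * Real.pi * Complex.I * (n a : ℂ) * coeff v n b := by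
    intro a b
    rw [← Torus.mFourierCoeff_complexify_apply (hv.partialDeriv a).integrable n b,
      Torus.mFourierCoeff_complexify_partialDeriv hv a n, PiLp.smul_apply, smul_eq_mul]
    rfl
  have hint : ∀ a b : Fin 3,
      Integrable (fun x => ((Torus.partialDeriv a v x b : ℝ) : ℂ)) volume := by
    intro a b
    have h := (((hv.partialDeriv a).apply b).comp_clm Complex.ofRealCLM).integrable
    simpa [Function.comp_def] using h
  have hfun : (fun x => ((Torus.partialDeriv a v x b - Torus.partialDeriv b v x a : ℝ) : ℂ)) =
      (fun x => ((Torus.partialDeriv a v x b : ℝ) : ℂ)) -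
        fun x => ((Torus.partialDeriv b v x a : ℝ) : ℂ) := by
    funext x
    simp only [Pi.sub_apply, Complex.ofReal_sub]
  rw [hfun, Torus.mFourierCoeff_sub (hint a b) (hint b a), hone a b, hone b a]
  ring

/-- Helper (`coeff_vort_apply_zero`), private to this discharge. [folklore] -/
private theorem coeff_vort_apply_zero {v : T3 → E3} (hv : Torus.IsSmooth v) (n : Z3) :
    coeff (vort v) n 0 =
      2 * Real.pi * Complex.I * ((n 1 : ℂ) * coeff v n 2 - (n 2 : ℂ) * coeff v n 1) := by
  have h1 : coeff (vort v) n 0 = UnitAddTorus.mFourierCoeff (fun x => ((vort v x 0 : ℝ) : ℂ)) n :=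
    Torus.mFourierCoeff_complexify_apply (isSmooth_vort hv).integrable n 0
  rw [h1]
  simp_rw [vort_apply_zero]
  exact mFourierCoeff_partialDeriv_pair hv 1 2 n

/-- Helper (`coeff_vort_apply_one`), private to this discharge. [folklore] -/
private theorem coeff_vort_apply_one {v : T3 → E3} (hv : Torus.IsSmooth v) (n : Z3) :
    coeff (vort v) n 1 =
      2 * Real.pi * Complex.I * ((n 2 : ℂ) * coeff v n 0 - (n 0 : ℂ) * coeff v n 2) := by
  have h1 : coeff (vort v) n 1 = UnitAddTorus.mFourierCoeff (fun x => ((vort v x 1 : ℝ) : ℂ)) n :=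
    Torus.mFourierCoeff_complexify_apply (isSmooth_vort hv).integrable n 1
  rw [h1]
  simp_rw [vort_apply_one]
  exact mFourierCoeff_partialDeriv_pair hv 2 0 n

/-- Helper (`coeff_vort_apply_two`), private to this discharge. [folklore] -/
private theorem coeff_vort_apply_two {v : T3 → E3} (hv : Torus.IsSmooth v) (n : Z3) :
    coeff (vort v) n 2 =
      2 * Real.pi * Complex.I * ((n 0 : ℂ) * coeff v n 1 - (n 1 : ℂ) * coeff v n 0) := by
  have h1 : coeff (vort v) n 2 = UnitAddTorus.mFourierCoeff (fun x => ((vort v x 2 : ℝ) : ℂ)) n :=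
    Torus.mFourierCoeff_complexify_apply (isSmooth_vort hv).integrable n 2
  rw [h1]
  simp_rw [vort_apply_two]
  exact mFourierCoeff_partialDeriv_pair hv 0 1 n

/-! ### (d) `curl((v·∇)v) = (v·∇)ω − (ω·∇)v` for smooth divergence-free `v` -/

/-- Components of `∂ₘ((v·∇)v)`: `∑ᵢ vᵢ ∂ᵢ∂ₘv_b + ∑ᵢ ∂ₘvᵢ ∂ᵢv_b`. [folklore] -/
private theorem partialDeriv_convect_self_apply {v : T3 → E3} (hv : Torus.IsSmooth v)
    (m b : Fin 3) (x : T3) :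
    Torus.partialDeriv m (Torus.convect v v) x b =
      (∑ i, v x i * Torus.partialDeriv i (Torus.partialDeriv m v) x b) +
        ∑ i, Torus.partialDeriv m v x i * Torus.partialDeriv i v x b := by
  have hv1 : Torus.IsContDiff 1 v := hv.isContDiff (by simp)
  have hD1 : Torus.IsContDiff 1 (Torus.partialDeriv m v) := (hv.partialDeriv m).isContDiff (by simp)
  rw [Torus.partialDeriv_convect_self_eq_add hv m x, PiLp.add_apply,
    Torus.convect_eq_sum_smul_partialDeriv hD1 x, Torus.convect_eq_sum_smul_partialDeriv hv1 x]
  simp [Finset.sum_apply]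

/-- Components of `(v·∇)w`: `∑ᵢ vᵢ (∂ᵢw)_b`. [folklore] -/
private theorem convect_apply {v w : T3 → E3} (hw : Torus.IsSmooth w) (b : Fin 3) (x : T3) :
    Torus.convect v w x b = ∑ i, v x i * Torus.partialDeriv i w x b := by
  have hw1 : Torus.IsContDiff 1 w := hw.isContDiff (by simp)
  rw [Torus.convect_eq_sum_smul_partialDeriv hw1 x]
  simp [Finset.sum_apply]

/-- `∂ᵢ` of an antisymmetrised derivative pair: `∂ᵢ(∂_a v_b − ∂_b v_a) = (∂ᵢ∂_a v)_b − (∂ᵢ∂_b v)_a`. [folklore] -/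
private theorem partialDeriv_pair {v : T3 → E3} (hv : Torus.IsSmooth v) (i a b : Fin 3) (x : T3) :
    Torus.partialDeriv i (fun y => Torus.partialDeriv a v y b - Torus.partialDeriv b v y a) x =
      Torus.partialDeriv i (Torus.partialDeriv a v) x b - Torus.partialDeriv i (Torus.partialDeriv b v) x a := by
  have hsa : Torus.IsSmooth (fun y => Torus.partialDeriv a v y b) := (hv.partialDeriv a).apply b
  have hsb : Torus.IsSmooth (fun y => Torus.partialDeriv b v y a) := (hv.partialDeriv b).apply a
  have e : (fun y => Torus.partialDeriv a v y b - Torus.partialDeriv b v y a) =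
      (fun y => Torus.partialDeriv a v y b) - fun y => Torus.partialDeriv b v y a := rfl
  rw [e, Torus.partialDeriv_sub (hsa.isContDiff (by simp)) (hsb.isContDiff (by simp)), Pi.sub_apply,
    Torus.partialDeriv_apply_coord ((hv.partialDeriv a).isContDiff (by simp)) i x b,
    Torus.partialDeriv_apply_coord ((hv.partialDeriv b).isContDiff (by simp)) i x a]

/-- Components of `∂ᵢ ω`. [folklore] -/
private theorem partialDeriv_vort_apply {v : T3 → E3} (hv : Torus.IsSmooth v) (i : Fin 3) (x : T3) :
    Torus.partialDeriv i (vort v) x 0 =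
        Torus.partialDeriv i (Torus.partialDeriv 1 v) x 2 - Torus.partialDeriv i (Torus.partialDeriv 2 v) x 1 ∧
      Torus.partialDeriv i (vort v) x 1 =
        Torus.partialDeriv i (Torus.partialDeriv 2 v) x 0 - Torus.partialDeriv i (Torus.partialDeriv 0 v) x 2 ∧
      Torus.partialDeriv i (vort v) x 2 =
        Torus.partialDeriv i (Torus.partialDeriv 0 v) x 1 - Torus.partialDeriv i (Torus.partialDeriv 1 v) x 0 := by
  have hω1 : Torus.IsContDiff 1 (vort v) := (isSmooth_vort hv).isContDiff (by simp)
  refine ⟨?_, ?_, ?_⟩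
  · rw [← Torus.partialDeriv_apply_coord hω1 i x 0]
    simp_rw [vort_apply_zero]
    exact partialDeriv_pair hv i 1 2 x
  · rw [← Torus.partialDeriv_apply_coord hω1 i x 1]
    simp_rw [vort_apply_one]
    exact partialDeriv_pair hv i 2 0 x
  · rw [← Torus.partialDeriv_apply_coord hω1 i x 2]
    simp_rw [vort_apply_two]
    exact partialDeriv_pair hv i 0 1 x

/-- **`curl((v·∇)v) = (v·∇)ω − (ω·∇)v`** for a smooth divergence-free field on `𝕋³`
(`ω = curl v`): the vorticity form of the inertial term. [folklore] -/
private theorem vort_convect_self {v : T3 → E3} (hv : Torus.IsSmooth v) (hdiv : Torus.IsDivFree v)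
    (x : T3) :
    vort (Torus.convect v v) x = Torus.convect v (vort v) x - Torus.convect (vort v) v x := by
  have hv1 : Torus.IsContDiff 1 v := hv.isContDiff (by simp)
  have hω : Torus.IsSmooth (vort v) := isSmooth_vort hv
  have hdiv' : Torus.partialDeriv 0 v x 0 + Torus.partialDeriv 1 v x 1 + Torus.partialDeriv 2 v x 2 = 0 := by
    have h := hdiv x
    rwa [Torus.divergence_eq_sum_partialDeriv_apply hv1, Fin.sum_univ_three] at h
  have hA := partialDeriv_convect_self_apply hv
  have hB := fun b => convect_apply (v := v) hω b x
  have hC := fun b => convect_apply (v := vort v) hv b x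
  have hP := fun i => partialDeriv_vort_apply hv i x
  ext c
  fin_cases c
  · show vort (Torus.convect v v) x 0 = (Torus.convect v (vort v) x - Torus.convect (vort v) v x) 0
    rw [PiLp.sub_apply, vort_apply_zero, hA, hA, hB, hC]
    simp only [Fin.sum_univ_three, (hP _).1, vort_apply_zero, vort_apply_one, vort_apply_two]
    linear_combination (Torus.partialDeriv 1 v x 2 - Torus.partialDeriv 2 v x 1) * hdiv'
  · show vort (Torus.convect v v) x 1 = (Torus.convect v (vort v) x - Torus.convect (vort v) v x) 1
    rw [PiLp.sub_apply, vort_apply_one, hA, hA, hB, hC]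
    simp only [Fin.sum_univ_three, (hP _).2.1, vort_apply_zero, vort_apply_one, vort_apply_two]
    linear_combination (Torus.partialDeriv 2 v x 0 - Torus.partialDeriv 0 v x 2) * hdiv'
  · show vort (Torus.convect v v) x 2 = (Torus.convect v (vort v) x - Torus.convect (vort v) v x) 2
    rw [PiLp.sub_apply, vort_apply_two, hA, hA, hB, hC]
    simp only [Fin.sum_univ_three, (hP _).2.2, vort_apply_zero, vort_apply_one, vort_apply_two]
    linear_combination (Torus.partialDeriv 0 v x 1 - Torus.partialDeriv 1 v x 0) * hdiv'


/-- `𝓕(curl((v·∇)v))(n) = −𝓕(G)(n)`, `G = (ω·∇)v − (v·∇)ω = stretchAdv v`. [folklore] -/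
private theorem coeff_vort_convect_self {v : T3 → E3} (hv : Torus.IsSmooth v)
    (hdiv : Torus.IsDivFree v) (n : Z3) :
    coeff (vort (Torus.convect v v)) n = -coeff (stretchAdv v) n := by
  have e : vort (Torus.convect v v) = -stretchAdv v := by
    funext x
    rw [vort_convect_self hv hdiv x, Pi.neg_apply, stretchAdv, neg_sub]
  rw [e]
  show UnitAddTorus.mFourierCoeff (EuclideanSpace.complexify ∘ (-stretchAdv v)) n =
    -UnitAddTorus.mFourierCoeff (EuclideanSpace.complexify ∘ stretchAdv v) n
  have e2 : EuclideanSpace.complexify ∘ (-stretchAdv v) = -(EuclideanSpace.complexify ∘ stretchAdv v) := by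
    funext x
    simp only [Function.comp_apply, Pi.neg_apply, map_neg]
  rw [e2, Torus.mFourierCoeff_neg]

/-! ### (a) Time derivatives of Fourier coefficients within a convex time set -/

/-- `d/ds 𝓕(u(s))(n) = 𝓕(∂ₜu(t))(n)` within a convex time set `S` (one-sided at endpoints), for a
field jointly smooth on `S × 𝕋³` — the `S`-version of `Torus.hasDerivAt_mFourierCoeff_slice`. [folklore] -/
private theorem hasDerivWithinAt_coeff {S : Set ℝ} {u : ℝ → T3 → E3}
    (hu : Torus.IsSmoothSpaceTimeOn S u) (hS : Convex ℝ S) (hU : UniqueDiffOn ℝ S)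
    (n : Z3) {t : ℝ} (ht : t ∈ S) :
    HasDerivWithinAt (fun s => coeff (u s) n) (coeff (Torus.timeDerivWithin S u t) n) S t := by
  set Φ : ℝ → T3 → C3 :=
    fun s y => UnitAddTorus.mFourier (-n) y • EuclideanSpace.complexify (u s y) with hΦ
  have hΦs : Torus.IsSmoothSpaceTimeOn S Φ := by
    have h1 : Torus.IsSmoothSpaceTimeOn S (fun s y => EuclideanSpace.complexify (u s y)) :=
      hu.clm_comp EuclideanSpace.complexify.toContinuousLinearMap
    have hχ : ContDiff ℝ ∞ (fun q : ℝ × EuclideanSpace ℝ (Fin 3) =>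
        UnitAddTorus.mFourier (-n) (Torus.proj q.2)) :=
      (Torus.isSmooth_mFourier (-n)).comp contDiff_snd
    unfold Torus.IsSmoothSpaceTimeOn at h1 ⊢
    exact hχ.contDiffOn.smul h1
  have hder := hΦs.hasDerivWithinAt_integral hS ht
  have hfun : (fun s => ∫ x, Φ s x) = fun s => coeff (u s) n := by
    funext s
    show (∫ x, Φ s x) = UnitAddTorus.mFourierCoeff (EuclideanSpace.complexify ∘ u s) n
    rw [Torus.mFourierCoeff_eq_integral_volume]
    rfl
  have hpt : ∀ y, Torus.timeDerivWithin S Φ t y =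
      UnitAddTorus.mFourier (-n) y • EuclideanSpace.complexify (Torus.timeDerivWithin S u t y) := by
    intro y
    have h1 := hu.hasDerivWithinAt_slice ht y
    have h2 := ((EuclideanSpace.complexify (ι := Fin 3)).toContinuousLinearMap.hasFDerivAt.comp_hasDerivWithinAt
      t h1).const_smul (UnitAddTorus.mFourier (-n) y)
    exact h2.derivWithin (hU t ht)
  have hint : (∫ y, Torus.timeDerivWithin S Φ t y) = coeff (Torus.timeDerivWithin S u t) n := by
    show _ = UnitAddTorus.mFourierCoeff (EuclideanSpace.complexify ∘ Torus.timeDerivWithin S u t) n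
    rw [Torus.mFourierCoeff_eq_integral_volume]
    exact integral_congr_ae (ae_of_all _ fun y => hpt y)
  rw [hfun, hint] at hder
  exact hder

/-! ### (c) The momentum equation at the level of Fourier coefficients -/

/-- Helper (`coeff_sub`), private to this discharge. [folklore] -/
private theorem coeff_sub {f g : T3 → E3} (hf : Torus.IsSmooth f) (hg : Torus.IsSmooth g) (n : Z3) :
    coeff (f - g) n = coeff f n - coeff g n := by
  show UnitAddTorus.mFourierCoeff (EuclideanSpace.complexify ∘ (f - g)) n = _
  rw [Torus.complexify_comp_sub,
    Torus.mFourierCoeff_sub hf.complexify_comp.integrable hg.complexify_comp.integrable]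
  rfl

/-- Helper (`coeff_smul`), private to this discharge. [folklore] -/
private theorem coeff_smul (f : T3 → E3) (c : ℝ) (n : Z3) :
    coeff (c • f) n = (c : ℂ) • coeff f n := by
  show UnitAddTorus.mFourierCoeff (EuclideanSpace.complexify ∘ (c • f)) n = _
  have e : EuclideanSpace.complexify ∘ (c • f) = (c : ℂ) • (EuclideanSpace.complexify ∘ f) := by
    funext x
    simp only [Function.comp_apply, Pi.smul_apply, map_smul, Complex.coe_smul]
  rw [e, Torus.mFourierCoeff_const_smul]
  rfl

/-- `𝓕(∂ₜu)(n)ⱼ = −ν 4π²|n|² ûⱼ(n) − 2πi nⱼ p̂(n) − 𝓕((u·∇)u)(n)ⱼ` along a classical solution of the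
unforced system on `[0, T) × 𝕋³`. [folklore] -/
private theorem coeff_timeDerivWithin_apply {ν T : ℝ} {u : ℝ → T3 → E3} {p : ℝ → T3 → ℝ}
    (h : Torus.IsClassicalNSSolutionOn (Ico 0 T) ν 0 u p) {t : ℝ} (ht : t ∈ Ico 0 T) (n : Z3)
    (j : Fin 3) :
    coeff (Torus.timeDerivWithin (Ico 0 T) u t) n j =
      (ν : ℂ) * (-((4 * Real.pi ^ 2 * Torus.freqNormSq n : ℝ) : ℂ) * coeff (u t) n j)
        - 2 * Real.pi * Complex.I * (n j : ℂ) * UnitAddTorus.mFourierCoeff (fun x => (p t x : ℂ)) n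
        - coeff (Torus.convect (u t) (u t)) n j := by
  have hut : Torus.IsSmooth (u t) := h.smooth_velocity.isSmooth_slice ht
  have hpt : Torus.IsSmooth (p t) := h.smooth_pressure.isSmooth_slice ht
  have hfun : Torus.timeDerivWithin (Ico 0 T) u t =
      (ν • Torus.laplacian (u t) - Torus.gradient (p t)) - Torus.convect (u t) (u t) := by
    funext x
    have hm := h.momentum t ht x
    simp only [Pi.zero_apply, add_zero] at hm
    simp only [Pi.sub_apply, Pi.smul_apply]
    rw [← hm]
    abel
  have hL : coeff (Torus.laplacian (u t)) n j =
      -((4 * Real.pi ^ 2 * Torus.freqNormSq n : ℝ) : ℂ) * coeff (u t) n j := by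
    show UnitAddTorus.mFourierCoeff (EuclideanSpace.complexify ∘ Torus.laplacian (u t)) n j = _
    rw [Torus.mFourierCoeff_complexify_laplacian hut n, PiLp.neg_apply, PiLp.smul_apply, smul_eq_mul,
      neg_mul]
    rfl
  have hG : coeff (Torus.gradient (p t)) n j =
      2 * Real.pi * Complex.I * (n j : ℂ) * UnitAddTorus.mFourierCoeff (fun x => (p t x : ℂ)) n :=
    Torus.mFourierCoeff_complexify_gradient_apply_eq hpt n j
  rw [hfun, coeff_sub ((hut.laplacian.smul ν).sub hpt.gradient) (hut.convect hut),
    coeff_sub (hut.laplacian.smul ν) hpt.gradient, coeff_smul, PiLp.sub_apply, PiLp.sub_apply,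
    PiLp.smul_apply, smul_eq_mul, hL, hG]


/-! ### (e) Assembly: the exact shell-enstrophy balance `dΩ_k/dt = T_k − D_k` -/

/-- **Lemma 5.1 (26)**: `d/dt Ω_k(t) = T_k(t) − D_k(t)` along every classical solution on `[0, T) × 𝕋³`
and every shell, as the one-sided derivative within `[0, T)` — DISCHARGED (D-0026 debt −1): per mode
`n`, `d/dt ω̂(n) = −ν4π²|n|² ω̂(n) + Ĝ(n)` (`Ĝ = 𝓕((ω·∇)u − (u·∇)ω)`, the pressure drops out under
`n ×`, the inertial term by `curl((u·∇)u) = (u·∇)ω − (ω·∇)u`), then `d‖ω̂(n)‖² = 2 Re⟪ω̂, ω̂'⟫` summed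
over the finite block `dyShell k`. [cite: Lietz2026, Lemma 5.1 (26) p.6 l.7–26] -/
theorem step_L51_holds : Step_L51 := by
  intro ν _hν T u p h k t ht
  have hS : Convex ℝ (Ico 0 T) := convex_Ico 0 T
  have hU : UniqueDiffOn ℝ (Ico 0 T) := uniqueDiffOn_Ico 0 T
  have hut : Torus.IsSmooth (u t) := h.smooth_velocity.isSmooth_slice ht
  have hdivt : Torus.IsDivFree (u t) := h.divFree t ht
  -- (a) velocity coefficients, componentwise
  have hcu : ∀ (n : Z3) (j : Fin 3), HasDerivWithinAt (fun s => coeff (u s) n j)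
      (coeff (Torus.timeDerivWithin (Ico 0 T) u t) n j) (Ico 0 T) t := by
    intro n j
    have h0 := hasDerivWithinAt_coeff h.smooth_velocity hS hU n ht
    exact ((EuclideanSpace.proj j : C3 →L[ℂ] ℂ).restrictScalars ℝ).hasFDerivAt.comp_hasDerivWithinAt t h0
  -- the nonlinear coefficient: `𝓕(curl((u·∇)u))(n) = −Ĝ(n)`
  have hGv : ∀ (n : Z3) (j : Fin 3), coeff (vort (Torus.convect (u t) (u t))) n j =
      -coeff (stretchAdv (u t)) n j := by
    intro n j
    rw [coeff_vort_convect_self hut hdivt n, PiLp.neg_apply]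
  have hconv : Torus.IsSmooth (Torus.convect (u t) (u t)) := hut.convect hut
  have hd := coeff_timeDerivWithin_apply h ht
  -- (b)+(c)+(d): the vorticity coefficients, componentwise
  have hω0 : ∀ n : Z3, HasDerivWithinAt (fun s => coeff (vort (u s)) n 0)
      ((ν : ℂ) * (-((4 * Real.pi ^ 2 * Torus.freqNormSq n : ℝ) : ℂ)) * coeff (vort (u t)) n 0
        + coeff (stretchAdv (u t)) n 0) (Ico 0 T) t := by
    intro n
    have h1 := (((hcu n 2).const_mul (n 1 : ℂ)).sub ((hcu n 1).const_mul (n 2 : ℂ))).const_mul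
      (2 * Real.pi * Complex.I)
    have h2 : HasDerivWithinAt (fun s => coeff (vort (u s)) n 0)
        (2 * Real.pi * Complex.I * ((n 1 : ℂ) * coeff (Torus.timeDerivWithin (Ico 0 T) u t) n 2
          - (n 2 : ℂ) * coeff (Torus.timeDerivWithin (Ico 0 T) u t) n 1)) (Ico 0 T) t :=
      h1.congr_of_mem (fun s hs => coeff_vort_apply_zero (h.smooth_velocity.isSmooth_slice hs) n) ht
    convert h2 using 1
    have hG0 := hGv n 0
    rw [coeff_vort_apply_zero hconv n] at hG0
    rw [hd n 2, hd n 1, coeff_vort_apply_zero hut n]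
    linear_combination hG0
  have hω1 : ∀ n : Z3, HasDerivWithinAt (fun s => coeff (vort (u s)) n 1)
      ((ν : ℂ) * (-((4 * Real.pi ^ 2 * Torus.freqNormSq n : ℝ) : ℂ)) * coeff (vort (u t)) n 1
        + coeff (stretchAdv (u t)) n 1) (Ico 0 T) t := by
    intro n
    have h1 := (((hcu n 0).const_mul (n 2 : ℂ)).sub ((hcu n 2).const_mul (n 0 : ℂ))).const_mul
      (2 * Real.pi * Complex.I)
    have h2 : HasDerivWithinAt (fun s => coeff (vort (u s)) n 1)
        (2 * Real.pi * Complex.I * ((n 2 : ℂ) * coeff (Torus.timeDerivWithin (Ico 0 T) u t) n 0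
          - (n 0 : ℂ) * coeff (Torus.timeDerivWithin (Ico 0 T) u t) n 2)) (Ico 0 T) t :=
      h1.congr_of_mem (fun s hs => coeff_vort_apply_one (h.smooth_velocity.isSmooth_slice hs) n) ht
    convert h2 using 1
    have hG1 := hGv n 1
    rw [coeff_vort_apply_one hconv n] at hG1
    rw [hd n 0, hd n 2, coeff_vort_apply_one hut n]
    linear_combination hG1
  have hω2 : ∀ n : Z3, HasDerivWithinAt (fun s => coeff (vort (u s)) n 2)
      ((ν : ℂ) * (-((4 * Real.pi ^ 2 * Torus.freqNormSq n : ℝ) : ℂ)) * coeff (vort (u t)) n 2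
        + coeff (stretchAdv (u t)) n 2) (Ico 0 T) t := by
    intro n
    have h1 := (((hcu n 1).const_mul (n 0 : ℂ)).sub ((hcu n 0).const_mul (n 1 : ℂ))).const_mul
      (2 * Real.pi * Complex.I)
    have h2 : HasDerivWithinAt (fun s => coeff (vort (u s)) n 2)
        (2 * Real.pi * Complex.I * ((n 0 : ℂ) * coeff (Torus.timeDerivWithin (Ico 0 T) u t) n 1
          - (n 1 : ℂ) * coeff (Torus.timeDerivWithin (Ico 0 T) u t) n 0)) (Ico 0 T) t :=
      h1.congr_of_mem (fun s hs => coeff_vort_apply_two (h.smooth_velocity.isSmooth_slice hs) n) ht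
    convert h2 using 1
    have hG2 := hGv n 2
    rw [coeff_vort_apply_two hconv n] at hG2
    rw [hd n 1, hd n 0, coeff_vort_apply_two hut n]
    linear_combination hG2
  -- (e) norms: `d‖z‖² = 2 Re (z̄ z')` for complex-valued `z`
  have hnsq : ∀ (z : ℝ → ℂ) (z' : ℂ), HasDerivWithinAt z z' (Ico 0 T) t →
      HasDerivWithinAt (fun s => ‖z s‖ ^ 2) (2 * (conj (z t) * z').re) (Ico 0 T) t := by
    intro z z' hz
    have h1 := hz.norm_sq
    convert h1 using 2
    rw [Complex.inner, mul_comm]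
  have hnorm : ∀ n : Z3, HasDerivWithinAt (fun s => ‖coeff (vort (u s)) n‖ ^ 2)
      (-(2 * ν * (4 * Real.pi ^ 2 * Torus.freqNormSq n)) * ‖coeff (vort (u t)) n‖ ^ 2
        + 2 * (inner ℂ (coeff (vort (u t)) n) (coeff (stretchAdv (u t)) n)).re) (Ico 0 T) t := by
    intro n
    have e : (fun s => ‖coeff (vort (u s)) n‖ ^ 2) = fun s =>
        ‖coeff (vort (u s)) n 0‖ ^ 2 + ‖coeff (vort (u s)) n 1‖ ^ 2 + ‖coeff (vort (u s)) n 2‖ ^ 2 := by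
      funext s
      rw [EuclideanSpace.norm_sq_eq, Fin.sum_univ_three]
    rw [e]
    have h3 := ((hnsq _ _ (hω0 n)).add (hnsq _ _ (hω1 n))).add (hnsq _ _ (hω2 n))
    have h4 : HasDerivWithinAt (fun s =>
        ‖coeff (vort (u s)) n 0‖ ^ 2 + ‖coeff (vort (u s)) n 1‖ ^ 2 + ‖coeff (vort (u s)) n 2‖ ^ 2) _
        (Ico 0 T) t := h3
    refine h4.congr_deriv ?_
    rw [EuclideanSpace.norm_sq_eq, Fin.sum_univ_three]
    simp only [PiLp.inner_apply, Fin.sum_univ_three, Complex.add_re, Complex.add_im, Complex.mul_re,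
      Complex.mul_im, Complex.neg_re, Complex.neg_im, Complex.ofReal_re,
      Complex.ofReal_im, Complex.conj_re, Complex.conj_im, Complex.sq_norm, Complex.normSq_apply,
      RCLike.inner_apply]
    ring
  -- sum over the finite block
  have hsum := HasDerivWithinAt.fun_sum (u := dyShell k) fun n _ => hnorm n
  have efun : (fun s => Om k (u s)) = fun s => ∑ n ∈ dyShell k, ‖coeff (vort (u s)) n‖ ^ 2 := by
    funext s
    rfl
  rw [efun]
  refine hsum.congr_deriv ?_
  simp only [Tk, Dk, Finset.mul_sum, ← Finset.sum_sub_distrib]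
  refine Finset.sum_congr rfl fun n _ => ?_
  ring

end StepL51Discharge

end

end Literature.Claims.NS.Lietz2026
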